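import Mathlib
import HarnessLib
import Summits.HubbardSuperconductivity.HubbardSuperconductivity.Theorems.KLProgrammeKLRegimeTwoVolumeFrameResponse
import Summits.HubbardSuperconductivity.HubbardSuperconductivity.Theorems.KLProgrammeKLRegimeTwoVolumeFrameDefect

/-!
# Route `KLProgramme` — crux K3, VL child `KLRegimeVolumeLimitV17F2` (stmt-HubbardSuperconductivity-20440), ROUTE A bracket (A4) ON THE MODEL, FROM THE TOWER:
# the frame-response bracket between the two volumes' flow frames as a pinned kernel-difference bound
# (cell gate-hubbard-kl, seat hubbard-kl-k3c5-p3 g9, technique «OS-positivity-free direct assembly»)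

`…TwoVolumeFrameResponse.sum_norm_kernel_effAction_add_sub_le_response_of_gramBounded` (p545036) bounds `effAction (C+E) W − effAction C W` at a pin from
the Gram property of the path `C + tE`, row/column sums of `C`, the entry sup / row / column sums of `E`, and the unweighted profile of `W`.
`…TwoVolumeFrameDefect` (p542415) supplies, FROM THE TOWER `TowerP klPredsV17F2`, the row/column sums and the entry sup of the two-volume frame defect
`Sᵀ(C^{K_n^{(L,M)}}_{>Λ} − C^{K_n^{(L′,M′)}}_{>Λ})S` on any Hubbard grid, every term `∝ c_j(n)/L`.  This file composes the two:

* **`sum_norm_kernel_frameResponse_le_of_towerV17F2`** — for the grid covariances `C = Sᵀ C^{K_n^{(L,M)}}_{>Λ} S`, `C′ = Sᵀ C^{K_n^{(L′,M′)}}_{>Λ} S` on the grid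
  legs of ANY volume `L₂` (cutoff `Mc ≥ 2`, `2Mc ≤ Ng`), Gram properties `κ, κ′`, row/column sums `αC` of `C`, an even interaction `W` without constant part
  and with unweighted pinned profile `N`, any majorants `cR ≥ [the tower's row/column-sum bound]`, `sE ≥ [the tower's entry bound]`, and the smallness
  `e·(αC + 2cR)·normV(κ+κ′,ρ,N)/(κ+κ′)² < 1`:
  `Σ_{X : X_p = w} ‖kernel (effAction C′ W) (m+1) X − kernel (effAction C W) (m+1) X‖ ≤ C(m+3,2)·sE·B(m+3) + ‖2⁻¹‖Σ_{a+b=m+1}(a+1)(b+1)·(cR·B B + cR·B B)`,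
  `B(k) = ρ⁻ᵏ·e·normV/(1−θ)` — the third bracket of the scale-`n` two-volume step under scheme F, BY NAME, with `cR, sE = O((Σ_{j<n} c_j)/L)`.

Proofs only; no definition.  References: BGM 2006 §2–§3 ((2.13)–(2.14), (2.77)–(2.80)); Salmhofer 1999 (2.102)–(2.106).
-/

noncomputable section

namespace Summit.HubbardSuperconductivity.HubbardSuperconductivity.Theorems.TwoVolumeDefect

set_option linter.dupNamespace false -- summit = problem name (single-conjunct summit), D-0017

open Finset Literature.MathematicalPhysics.QuantumLattice GrassmannAlgebra Literature.Probability.LatticeModels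
open Summit.HubbardSuperconductivity.HubbardSuperconductivity.Theorems.KLRegimeSplit
open Summit.HubbardSuperconductivity.HubbardSuperconductivity.Theorems.KLProgrammeLegKernels
open Summit.HubbardSuperconductivity.HubbardSuperconductivity.Theorems.DispersionFlow
open Summit.HubbardSuperconductivity.HubbardSuperconductivity.Theorems.TwoPointAssembly
open scoped Nat

/-- **THE TWO-VOLUME FRAME-RESPONSE BRACKET ON THE MODEL, FROM THE TOWER** ((A4) by name as a kernel-difference bound).  See the module docstring.
[cite: BenfattoGiulianiMastropietro2006, (2.13)-(2.14) and (2.77)-(2.80)] -/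
theorem sum_norm_kernel_frameResponse_le_of_towerV17F2
    {G : GeoConsts} {P : SplitConsts} {Q : EngConsts} {R : RenConsts} {β U μ : ℝ} {K₀ : TrigPolyC4v} {Lstar : ℕ} {Mstar : ℕ → ℕ}
    (hμ : μ ∈ klWindowC) (hβ : 0 < β) (hT : TowerP klPredsV17F2 G P Q R β U μ K₀ Lstar Mstar)
    {L : ℕ} [NeZero L] (hL : Lstar ≤ L) {L' : ℕ} [NeZero L'] (hLL' : L ≤ L')
    {M : ℕ} [NeZero M] (hM₁ : Mstar L ≤ M) (hM₂ : Q.M0 β L ≤ M) {M' : ℕ} [NeZero M'] (hM'₁ : Mstar L' ≤ M') (hM'₂ : Q.M0 β L' ≤ M')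
    {n : ℕ} (hn : n ≤ nScales β + 1) {Λ : ℝ} (hΛ : 0 < Λ)
    {L₂ Mc Ng : ℕ} [NeZero L₂] [NeZero Ng] [LinearOrder (GridLeg (GridPoint L₂ Ng))] (hMc : 2 ≤ Mc) (hMN : 2 * Mc ≤ Ng) {s₀ : ℝ} (hs₀ : 0 < s₀)
    (C C' : Matrix (GridLeg (GridPoint L₂ Ng)) (GridLeg (GridPoint L₂ Ng)) ℂ)
    (hC : C = (hubbardGridSub L₂ Mc β Ng).transpose * hubbardCovAboveCT L₂ Mc β μ 0 (klFlowFrameU L M β U μ n) Λ * hubbardGridSub L₂ Mc β Ng)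
    (hC' : C' = (hubbardGridSub L₂ Mc β Ng).transpose * hubbardCovAboveCT L₂ Mc β μ 0 (klFlowFrameU L' M' β U μ n) Λ * hubbardGridSub L₂ Mc β Ng)
    {κ κ' : ℝ} (hκ : 0 < κ) (hκ' : 0 ≤ κ') (hGB : IsGramBoundedR C κ) (hGB' : IsGramBoundedR C' κ')
    {αC : ℝ} (hαC : 0 < αC) (hrow : ∀ X, ∑ Y, ‖C X Y‖ ≤ αC) (hcol : ∀ Y, ∑ X, ‖C X Y‖ ≤ αC)
    (W : GrassmannAlgebra ℂ (GridLeg (GridPoint L₂ Ng))) (hWe : W ∈ evenPart ℂ (GridLeg (GridPoint L₂ Ng))) (hW0 : constPart ℂ W = 0)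
    (N : ℕ → ℝ) (hN0 : ∀ m', 0 ≤ N m')
    (hN : ∀ m' (j : Fin (2 * m')) (x : GridLeg (GridPoint L₂ Ng)),
      ∑ Y ∈ univ.filter (fun Y : Fin (2 * m') → GridLeg (GridPoint L₂ Ng) => Y j = x), ‖kernel ℂ W (2 * m') Y‖ ≤ N m')
    {cR : ℝ} (hcR :
      Real.sqrt ((2 + 12 / s₀) * 14 ^ 2) *
        Real.sqrt ((Ng : ℝ) ^ 1 * (L₂ : ℝ) ^ 2 *
          ((L₂ : ℝ) ^ 2 * ((1 / (β * (L₂ : ℝ) ^ 2)) ^ 4 * (β * (L₂ : ℝ) ^ 2) ^ 2 *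
              (uvMixedConst Λ 0 1 * ((∑ m ∈ range n, 4 * (2 * klFlowDeg m + 1) * (1 + 4 * klFlowDeg m) ^ 0 * Q.CL β m) / L)) ^ 2 *
                ((2 / Λ) ^ (2 * 1) * (2 * β / Λ))) +
            ((Ng : ℝ) * s₀ / 4) ^ 4 *
              ((L₂ : ℝ) ^ 2 * ((1 / (β * (L₂ : ℝ) ^ 2)) ^ 4 * (β * (L₂ : ℝ) ^ 2) ^ 2 * (2 * Real.pi / β) ^ 4 *
                  (uvMixedConst Λ 2 1 * ((∑ m ∈ range n, 4 * (2 * klFlowDeg m + 1) * (1 + 4 * klFlowDeg m) ^ 0 * Q.CL β m) / L)) ^ 2 *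
                    (4 ^ 4 * ((2 / Λ) ^ (2 * 4 - 2) * (2 * β / Λ)) + 4 * (2 : ℕ) * (2 / Λ) ^ (2 * 4))) +
                4 * ((L₂ : ℝ) ^ 2 * (4 * ((1 / (β * (L₂ : ℝ) ^ 2)) ^ 2 * ((β * (L₂ : ℝ) ^ 2) *
                  (uvMixedConst Λ 0 1 * ((∑ m ∈ range n, 4 * (2 * klFlowDeg m + 1) * (1 + 4 * klFlowDeg m) ^ 0 * Q.CL β m) / L) *
                    (β / (Real.pi * (2 * Mc - 3))) ^ 2)))) ^ 2)) +
            2 * (((L₂ : ℝ) / 4) ^ 4 *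
              ((L₂ : ℝ) ^ 2 * ((1 / (β * (L₂ : ℝ) ^ 2)) ^ 4 * (β * (L₂ : ℝ) ^ 2) ^ 2 * (2 * Real.pi / L₂) ^ 4 *
                (uvMixedConst Λ 0 3 * (2 / Λ) ^ 2 * (7 : ℝ) ^ 2 *
                    ((∑ m ∈ range n, 4 * (2 * klFlowDeg m + 1) * (1 + 4 * klFlowDeg m) ^ 0 * Q.CL β m) / L) +
                  uvMixedConst Λ 0 2 * (2 / Λ) *
                    ((7 : ℝ) * ((∑ m ∈ range n, 4 * (2 * klFlowDeg m + 1) * (1 + 4 * klFlowDeg m) ^ 0 * Q.CL β m) / L) +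
                      2 * 7 * ((∑ m ∈ range n, 4 * (2 * klFlowDeg m + 1) * (1 + 4 * klFlowDeg m) ^ 1 * Q.CL β m) / L)) +
                  uvMixedConst Λ 0 1 * ((∑ m ∈ range n, 4 * (2 * klFlowDeg m + 1) * (1 + 4 * klFlowDeg m) ^ 2 * Q.CL β m) / L)) ^ 2 *
                  ((2 / Λ) ^ (2 * 1) * (2 * β / Λ))))))) ≤ cR)
    {sE : ℝ} (hsE :
      (L₂ : ℝ) ^ 2 * ((1 / (β * (L₂ : ℝ) ^ 2)) ^ 2 * (β * (L₂ : ℝ) ^ 2) *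
        (uvMixedConst Λ 0 1 * ((∑ m ∈ range n, Q.CL β m) / L)) * ((2 / Λ) ^ (2 * 0) * (2 * β / Λ))) ≤ sE)
    {ρ : ℝ} (hρ : 0 < ρ)
    (hθ : Real.exp 1 * (αC + (cR + cR)) * normV (GridLeg (GridPoint L₂ Ng)) (κ + κ') ρ N / (κ + κ') ^ 2 < 1)
    (w : GridLeg (GridPoint L₂ Ng)) (m : ℕ) (p : Fin (m + 1)) :
    ∑ X ∈ univ.filter (fun X : Fin (m + 1) → GridLeg (GridPoint L₂ Ng) => X p = w),
        ‖kernel ℂ (effAction ℂ C' W) (m + 1) X - kernel ℂ (effAction ℂ C W) (m + 1) X‖ ≤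
      (((m + 1 + 1) * (m + 1 + 2) : ℕ) : ℝ) / 2 * sE * ((ρ⁻¹ ^ (m + 3) * (Real.exp 1 * normV (GridLeg (GridPoint L₂ Ng)) (κ + κ') ρ N)) / (1 - Real.exp 1 * (αC + (cR + cR)) * normV (GridLeg (GridPoint L₂ Ng)) (κ + κ') ρ N / (κ + κ') ^ 2)) +
        ‖(2 : ℂ)⁻¹‖ * ∑ a ∈ range (m + 2), ∑ b ∈ range (m + 2),
          (if a + b = m + 1 then (((a + 1) * (b + 1) : ℕ) : ℝ) * (cR * ((ρ⁻¹ ^ (a + 1) * (Real.exp 1 * normV (GridLeg (GridPoint L₂ Ng)) (κ + κ') ρ N)) / (1 - Real.exp 1 * (αC + (cR + cR)) * normV (GridLeg (GridPoint L₂ Ng)) (κ + κ') ρ N / (κ + κ') ^ 2)) * ((ρ⁻¹ ^ (b + 1) * (Real.exp 1 * normV (GridLeg (GridPoint L₂ Ng)) (κ + κ') ρ N)) / (1 - Real.exp 1 * (αC + (cR + cR)) * normV (GridLeg (GridPoint L₂ Ng)) (κ + κ') ρ N / (κ + κ') ^ 2)) + cR * ((ρ⁻¹ ^ (a + 1) *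 (Real.exp 1 * normV (GridLeg (GridPoint L₂ Ng)) (κ + κ') ρ N)) / (1 - Real.exp 1 * (αC + (cR + cR)) * normV (GridLeg (GridPoint L₂ Ng)) (κ + κ') ρ N / (κ + κ') ^ 2)) * ((ρ⁻¹ ^ (b + 1) * (Real.exp 1 * normV (GridLeg (GridPoint L₂ Ng)) (κ + κ') ρ N)) / (1 - Real.exp 1 * (αC + (cR + cR)) * normV (GridLeg (GridPoint L₂ Ng)) (κ + κ') ρ N / (κ + κ') ^ 2))) else 0) := by
  classical
  -- the frame defect `E := C′ − C` and its data from the tower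
  have hent : ∀ X Y, ‖(C' - C) X Y‖ ≤ sE := by
    intro X Y
    rw [Matrix.sub_apply, norm_sub_rev, ← Matrix.sub_apply, hC, hC']
    exact (norm_frameDefect_apply_le_of_towerV17F2 hμ hβ hT hL hLL' hM₁ hM₂ hM'₁ hM'₂ hn hΛ hMN X Y).trans hsE
  have hR : ∀ X, ∑ Y, ‖(C' - C) X Y‖ ≤ cR := by
    intro X
    have h : ∀ Y, ‖(C' - C) X Y‖ = ‖(C - C') X Y‖ := fun Y => by rw [Matrix.sub_apply, norm_sub_rev, ← Matrix.sub_apply]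
    simp_rw [h]
    rw [hC, hC']
    exact (rowSum_frameDefect_le_of_towerV17F2 hμ hβ hT hL hLL' hM₁ hM₂ hM'₁ hM'₂ hn hΛ hMc hMN hs₀ X).trans hcR
  have hCol : ∀ Y, ∑ X, ‖(C' - C) X Y‖ ≤ cR := by
    intro Y
    have h : ∀ X, ‖(C' - C) X Y‖ = ‖(C - C') X Y‖ := fun X => by rw [Matrix.sub_apply, norm_sub_rev, ← Matrix.sub_apply]
    simp_rw [h]
    rw [hC, hC']
    exact (colSum_frameDefect_le_of_towerV17F2 hμ hβ hT hL hLL' hM₁ hM₂ hM'₁ hM'₂ hn hΛ hMc hMN hs₀ Y).trans hcR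
  have hcR0 : 0 ≤ cR := (sum_nonneg fun Y _ => norm_nonneg _).trans (hR w)
  have hκκ : 0 < κ + κ' := by linarith
  have hGBpath : ∀ t ∈ Set.Icc (0 : ℝ) 1, IsGramBoundedR (C + t • (C' - C)) (κ + κ') := fun t ht =>
    isGramBoundedR_add_smul_sub hGB hGB' hκ.le ht
  have h := sum_norm_kernel_effAction_add_sub_le_response_of_gramBounded C (C' - C) W hWe hW0 N hN0
    (fun m' j x => by convert hN m' j x using 3) hκκ hGBpath hαC hrow hcol hent hcR0 hcR0 hR hCol hρ hθ w m p
  rw [add_sub_cancel] at h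
  convert h using 3

end Summit.HubbardSuperconductivity.HubbardSuperconductivity.Theorems.TwoVolumeDefect
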